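import Literature.AlgebraicGeometry.Resolution.OstrowskiPrimeDivisors
import Literature.AlgebraicGeometry.Resolution.GeneralizedStabilityRankOneVTGalois
import HarnessLib

/-!
# Ostrowski's lemma III: the Galois case over a henselian field

Topic: `Literature/AlgebraicGeometry/Resolution` (valued function fields). Third file of the
discharge of the named fact `Kuhlmann2010OstrowskiLemma` (the Lemma of Ostrowski, F.-V. Kuhlmann,
Trans. AMS 362 (2010) = arXiv:1003.5678, §2.3 (9)). For a finite GALOIS extension `F ≤ N` of
subfields of the ambient algebraically closed valued field `(Ω, V)` over a HENSELIAN `F`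
(so that `V ∩ N` is the unique extension of `V ∩ F` and the Galois group preserves the
valuation) we prove `[N : F] = e(N|F)·f(N|F)·p^ν`, `p` the residue characteristic exponent —
Zariski–Samuel II, Ch. VI §12, Thm. 25, Corollary ("`efg ∣ n` and `n/efg` is a power of `π`",
here `g = 1`) — by a Sylow-subgroup argument instead of the ramification groups:

1. `rel_mul_eq_of_isGalois_prime` — a Galois extension of PRIME degree `q ≠ p` of a henselian
   field is defectless (`e f = q`): were `e = f = 1`, the extension would be immediate, every
   automorphism would move every `x` by less than `v(x)` (`valuation_sub_lt_of_isImmediateOver`),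
   hence be trivial by the ramification lemma (`ringHom_apply_eq_self_of_valuation_sub_lt`,
   ZS VI §12, Thm. 24) — so `e f ≠ 1`, and the prime divisors of `e f` divide `q`
   (`dvd_relFinrank_of_prime_dvd`).
2. `rel_mul_eq_of_isGalois_prime_pow` — Galois of degree `q^a`, `q ≠ p`: `e f = q^a` (induction
   through a central subgroup of order `q` of the `q`-group `Gal(N|F)` and its fixed field,
   multiplicativity of `e`, `f`).
3. `exists_relFinrank_eq_mul_pow_of_isGalois` — the general Galois case: for every prime
   `r ≠ p` with Sylow `r`-subgroup `Q` and fixed field `S`, `e f(N|F) = e f(N|S)·e f(S|F)` with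
   `e f(N|S) = |Q|` (step 2, `S` being henselian) and `r ∤ e f(S|F)` (as `r ∤ [S:F] = (G:Q)`), so
   `e f` and `n` have the same `r`-adic valuation for all `r ≠ p`; with `e f ≤ n` this gives
   `n = e f · p^ν` (`exists_eq_mul_pow_of_factorization_eq`).

## Sources

* F.-V. Kuhlmann, Trans. AMS 362 (2010) = arXiv:1003.5678, §1.1, §2.3 (9), Lemma 2.3.
  [Kuhlmann2010]
* O. Zariski, P. Samuel, *Commutative Algebra* II (1960), Ch. VI §12, Thm. 24, Thm. 25 and
  Corollary (PDF pp. 100–101). [ZariskiSamuel1960]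

No definitions. The pair bookkeeping (`relFinrank`, `relRamificationIndex`, `relInertiaDegree`,
`RelFinite`, `rel_tower`) is that of `GeneralizedStabilityRankOneVTPairs.lean`, the passage
between intermediate fields and subfields (`liftSubfield`) that of
`GeneralizedStabilityRankOneVTGalois.lean`.
-/

noncomputable section

open IsLocalRing

namespace Literature.AlgebraicGeometry.Resolution

universe u

/-! ### Arithmetic: numbers with the same prime factorization away from `p` -/

section Arith

/-- If `0 < A ≤ B` have the same multiplicity at every prime `r ≠ p`, then `B = A·p^ν` for
some `ν` (if `p` is not prime, `A = B`). [folklore] -/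
theorem exists_eq_mul_pow_of_factorization_eq {p A B : ℕ} (hA : 0 < A) (hAB : A ≤ B)
    (h : ∀ r : ℕ, r.Prime → r ≠ p → A.factorization r = B.factorization r) :
    ∃ ν : ℕ, B = A * p ^ ν := by
  have hA0 : A ≠ 0 := hA.ne'
  have hB0 : B ≠ 0 := by omega
  by_cases hp : p.Prime
  · -- compare the parts prime to `p`
    set a := A.factorization p with ha
    set b := B.factorization p with hb
    have hA' := Nat.ordProj_mul_ordCompl_eq_self A p
    have hB' := Nat.ordProj_mul_ordCompl_eq_self B p
    have hcompl : A / p ^ a = B / p ^ b := by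
      refine Nat.eq_of_factorization_eq (Nat.ordCompl_pos p hA0).ne' (Nat.ordCompl_pos p hB0).ne'
        fun r => ?_
      rw [ha, hb, Nat.factorization_ordCompl, Nat.factorization_ordCompl]
      by_cases hrp : r = p
      · rw [hrp, Finsupp.erase_same, Finsupp.erase_same]
      rw [Finsupp.erase_ne hrp, Finsupp.erase_ne hrp]
      by_cases hr : r.Prime
      · exact h r hr hrp
      · rw [Nat.factorization_eq_zero_of_not_prime _ hr, Nat.factorization_eq_zero_of_not_prime _ hr]
    have hab : a ≤ b := by
      have hC : 0 < A / p ^ a := Nat.ordCompl_pos p hA0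
      have h1 : p ^ a * (A / p ^ a) ≤ p ^ b * (A / p ^ a) := by
        calc p ^ a * (A / p ^ a) = A := hA'
          _ ≤ B := hAB
          _ = p ^ b * (A / p ^ a) := by rw [hcompl]; exact hB'.symm
      exact (Nat.pow_le_pow_iff_right hp.two_le).mp (Nat.le_of_mul_le_mul_right h1 hC)
    refine ⟨b - a, ?_⟩
    calc B = p ^ b * (B / p ^ b) := hB'.symm
      _ = p ^ (b - a) * (p ^ a * (A / p ^ a)) := by
          rw [← hcompl, ← mul_assoc, ← pow_add, Nat.sub_add_cancel hab]
      _ = A * p ^ (b - a) := by rw [hA', mul_comm]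
  · -- `p` not prime: all multiplicities agree
    refine ⟨0, ?_⟩
    rw [pow_zero, mul_one]
    refine (Nat.eq_of_factorization_eq hA0 hB0 fun r => ?_).symm
    by_cases hr : r.Prime
    · exact h r hr (fun hrp => hp (hrp ▸ hr))
    · rw [Nat.factorization_eq_zero_of_not_prime _ hr, Nat.factorization_eq_zero_of_not_prime _ hr]

end Arith

/-! ### Galois extensions of a henselian subfield: automorphisms and the valuation -/

section Galois

variable {Ω : Type u} [Field Ω] [IsAlgClosed Ω] {V : ValuationSubring Ω}

omit [IsAlgClosed Ω] in
/-- A prime `q` different from the residue characteristic exponent is a unit of `V`: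
`v(q) = 1`. [folklore] -/
theorem valuation_natCast_eq_one_of_ne_ringExpChar {q : ℕ} (hq : q.Prime)
    (hqp : q ≠ ringExpChar (ResidueField V)) : V.valuation (q : Ω) = 1 := by
  have hqk : (q : ResidueField V) ≠ 0 := by
    intro h0
    have hdvd : ringChar (ResidueField V) ∣ q := (ringChar.spec _ q).mp h0
    rcases (Nat.dvd_prime hq).mp hdvd with h1 | h2
    · exact CharP.ringChar_ne_one h1
    · apply hqp
      have : ringExpChar (ResidueField V) = max (ringChar (ResidueField V)) 1 := rfl
      rw [this, h2]
      exact (max_eq_left hq.one_lt.le).symm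
  have hqV : ((q : V) : Ω) = (q : Ω) := by push_cast; rfl
  rw [← hqV, ← (V.valuation_eq_one_iff (q : V))]
  by_contra hnu
  apply hqk
  rw [← map_natCast (residue V), residue_eq_zero_iff]
  exact (IsLocalRing.mem_maximalIdeal _).mpr hnu

variable (V)

omit [IsAlgClosed Ω] in
/-- Over a henselian `F`, an `F`-automorphism of a finite `N ≥ F` (inside `Ω`) preserves the
valuation: `v(σ z) = v(z)`. [cite: Kuhlmann2010, Section 1.1] -/
theorem valuation_algEquiv_apply_of_isHenselianField {F N : Subfield Ω} (h : F ≤ N)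
    (hF : IsHenselianField F (V.comap (algebraMap F Ω))) (hfin : RelFinite F N h) :
    letI : Algebra F N := (Subfield.inclusion h).toAlgebra
    ∀ (σ : N ≃ₐ[F] N) (z : N), V.valuation ((σ z : N) : Ω) = V.valuation (z : Ω) := by
  letI : Algebra F N := (Subfield.inclusion h).toAlgebra
  haveI : IsScalarTower F N Ω := IsScalarTower.of_algebraMap_eq fun _ => rfl
  haveI : FiniteDimensional F N := hfin
  intro σ z
  exact hF.valuation_algHom_apply V ((IsScalarTower.toAlgHom F N Ω).comp σ.toAlgHom) z

/-- **A Galois extension of prime degree `q ≠ p` of a henselian field is defectless**: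
`e(N|F)·f(N|F) = q`. Were `e = f = 1`, `N|F` would be immediate, so every automorphism `σ`
satisfies `v(σ x - x) < v(x)` (`valuation_sub_lt_of_isImmediateOver`) and is trivial by the
ramification lemma (ZS VI §12, Thm. 24), contradicting `|Gal(N|F)| = q`; hence `e f ≠ 1`, and
as every prime divisor of `e f` divides `q` (`dvd_relFinrank_of_prime_dvd`) while `e f ≤ q`,
`e f = q`. [cite: ZariskiSamuel1960, Ch. VI §12, Thm. 24] -/
theorem rel_mul_eq_of_isGalois_prime {F N : Subfield Ω} (h : F ≤ N)
    (hF : IsHenselianField F (V.comap (algebraMap F Ω))) (hfin : RelFinite F N h)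
    (hgal : letI : Algebra F N := (Subfield.inclusion h).toAlgebra; IsGalois F N)
    {q : ℕ} (hq : q.Prime) (hqp : q ≠ ringExpChar (ResidueField V)) (hdeg : relFinrank F N h = q) :
    relRamificationIndex V F N h * relInertiaDegree V F N h = q := by
  letI : Algebra F N := (Subfield.inclusion h).toAlgebra
  haveI : IsScalarTower F N Ω := IsScalarTower.of_algebraMap_eq fun _ => rfl
  haveI : FiniteDimensional F N := hfin
  haveI : IsGalois F N := hgal
  set e := relRamificationIndex V F N h with he
  set f := relInertiaDegree V F N h with hf
  have hle : e * f ≤ q := hdeg ▸ relRamificationIndex_mul_relInertiaDegree_le (V := V) h hfin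
  obtain ⟨he1, hf1⟩ := one_le_relRamificationIndex_and_relInertiaDegree (V := V) h hfin
  -- `e f ≠ 1`
  have hne : e * f ≠ 1 := by
    intro h1
    have he' : e = 1 := Nat.eq_one_of_mul_eq_one_right h1
    have hf' : f = 1 := Nat.eq_one_of_mul_eq_one_left h1
    have himm : IsImmediateOver V F N := isImmediateOver_of_rel_eq_one h he' hf'
    -- every automorphism is trivial
    have hcard : Nat.card (N ≃ₐ[F] N) = q := by
      rw [IsGalois.card_aut_eq_finrank]
      exact hdeg
    have htriv : ∀ (σ : N ≃ₐ[F] N) (x : N), σ x = x := by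
      intro σ
      let s : N →+* N := σ.toAlgHom.toRingHom
      have hσq : σ ^ q = 1 := by
        rw [← hcard]
        exact pow_card_eq_one'
      have hsq : s ^ q = 1 := by
        refine RingHom.ext fun x => ?_
        rw [RingHom.coe_pow, RingHom.coe_one, id_eq]
        change (⇑σ)^[q] x = x
        rw [← AlgEquiv.coe_pow, hσq, AlgEquiv.one_apply]
      have hsF : ∀ c : N, (c : Ω) ∈ F → s c = c := fun c hc => by
        have : c = algebraMap F N ⟨c, hc⟩ := Subtype.ext rfl
        rw [this]
        exact σ.commutes _
      have hsv : ∀ z : N, V.valuation ((s z : N) : Ω) = V.valuation (z : Ω) :=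
        valuation_algEquiv_apply_of_isHenselianField V h hF hfin σ
      have hram := valuation_sub_lt_of_isImmediateOver V h himm s hsF hsv
      intro x
      refine ringHom_apply_eq_self_of_valuation_sub_lt (V.valuation.comap (algebraMap N Ω)) s hsq
        ?_ (fun y hy => ?_) x
      · rw [Valuation.comap_apply, map_natCast]
        exact valuation_natCast_eq_one_of_ne_ringExpChar hq hqp
      · rw [Valuation.comap_apply, Valuation.comap_apply, map_sub]
        exact hram y hy
    haveI : Subsingleton (N ≃ₐ[F] N) := ⟨fun a b => AlgEquiv.ext fun x => by rw [htriv a, htriv b]⟩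
    have h1' : Nat.card (N ≃ₐ[F] N) = 1 := Nat.card_of_subsingleton 1
    rw [h1'] at hcard
    exact hq.one_lt.ne' hcard.symm
  -- every prime divisor of `e f` divides `q`
  obtain ⟨r, hr, hrdvd⟩ := Nat.exists_prime_and_dvd hne
  have hrq : r ∣ q := hdeg ▸ dvd_relFinrank_of_prime_dvd V h hF hfin hr hrdvd
  have hrq' : r = q := (Nat.prime_dvd_prime_iff_eq hr hq).mp hrq
  rw [hrq'] at hrdvd
  have hpos : 0 < e * f := Nat.mul_pos he1 hf1
  have hqle : q ≤ e * f := Nat.le_of_dvd hpos hrdvd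
  omega

/-- **Galois extensions of degree `q^a`, `q ≠ p` prime, of a henselian field are defectless**:
`e f = q^a`, by induction on `a` through a central subgroup `C` of order `q` of the `q`-group
`Gal(N|F)`: its fixed field `N₁` is Galois of degree `q^(a-1)` over `F` and henselian, `N|N₁`
is Galois of degree `q` (`rel_mul_eq_of_isGalois_prime`), and `e`, `f` are multiplicative.
[cite: ZariskiSamuel1960, Ch. VI §12, Thm. 25] -/
theorem rel_mul_eq_of_isGalois_prime_pow {q : ℕ} (hq : q.Prime)
    (hqp : q ≠ ringExpChar (ResidueField V)) (a : ℕ) :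
    ∀ (F N : Subfield Ω) (h : F ≤ N), IsHenselianField F (V.comap (algebraMap F Ω)) →
      RelFinite F N h → (letI : Algebra F N := (Subfield.inclusion h).toAlgebra; IsGalois F N) →
      relFinrank F N h = q ^ a →
      relRamificationIndex V F N h * relInertiaDegree V F N h = q ^ a := by
  induction a with
  | zero =>
    intro F N h hF hfin hgal hdeg
    rw [pow_zero] at hdeg ⊢
    have := isDefectlessPair_of_relFinrank_eq_one (V := V) h hfin hdeg
    unfold IsDefectlessPair at this
    rw [this, hdeg]
  | succ a ih =>
    intro F N h hF hfin hgal hdeg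
    letI : Algebra F N := (Subfield.inclusion h).toAlgebra
    haveI : IsScalarTower F N Ω := IsScalarTower.of_algebraMap_eq fun _ => rfl
    haveI : FiniteDimensional F N := hfin
    haveI : IsGalois F N := hgal
    haveI : Fact q.Prime := ⟨hq⟩
    have hcard : Nat.card (N ≃ₐ[F] N) = q ^ (a + 1) := by
      rw [IsGalois.card_aut_eq_finrank]; exact hdeg
    have hG : IsPGroup q (N ≃ₐ[F] N) := IsPGroup.of_card hcard
    haveI : Nontrivial (N ≃ₐ[F] N) := by
      rw [← Finite.one_lt_card_iff_nontrivial, hcard]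
      exact Nat.one_lt_pow (by omega) hq.one_lt
    haveI := IsPGroup.center_nontrivial hG
    -- a central subgroup of order `q`
    have hZ : q ∣ Nat.card (Subgroup.center (N ≃ₐ[F] N)) := by
      rcases (hG.to_subgroup (Subgroup.center _)).card_eq_or_dvd with h1 | h1
      · exact absurd h1 (Finite.one_lt_card_iff_nontrivial.mpr inferInstance).ne'
      · exact h1
    obtain ⟨z, hz⟩ := exists_prime_orderOf_dvd_card' q hZ
    let g : N ≃ₐ[F] N := z
    have hg : orderOf g = q := by rw [Subgroup.orderOf_coe]; exact hz
    have hgZ : g ∈ Subgroup.center (N ≃ₐ[F] N) := z.2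
    let C : Subgroup (N ≃ₐ[F] N) := Subgroup.zpowers g
    haveI hCn : C.Normal := by
      refine ⟨fun x hx y => ?_⟩
      have hxZ : x ∈ Subgroup.center (N ≃ₐ[F] N) := (Subgroup.zpowers_le.mpr hgZ) hx
      have : y * x * y⁻¹ = x := by
        rw [Subgroup.mem_center_iff.mp hxZ y, mul_inv_cancel_right]
      rw [this]; exact hx
    have hCcard : Nat.card C = q := by rw [Nat.card_zpowers]; exact hg
    -- its fixed field `N₁`: `[N : N₁] = q`, `[N₁ : F] = q^a`, both Galois, `N₁` henselian
    let S : IntermediateField F N := IntermediateField.fixedField C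
    haveI : IsGalois F S := IsGalois.of_fixedField_normal_subgroup C
    let N₁ : Subfield Ω := liftSubfield S
    have hFN₁ : F ≤ N₁ := le_liftSubfield S
    have hN₁N : N₁ ≤ N := liftSubfield_le S
    have hN₁Ndeg : relFinrank N₁ N hN₁N = q := by
      rw [relFinrank_liftSubfield_eq, IntermediateField.finrank_fixedField_eq_card, hCcard]
    have hfinN₁N : RelFinite N₁ N hN₁N := relFinite_liftSubfield S
    have hfinFN₁ : RelFinite F N₁ hFN₁ := relFinite_liftSubfield_bot S
    have hgalFN₁ := isGalois_liftSubfield_bot (M := F) (E := N) S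
    have hgalN₁N := isGalois_liftSubfield_top (M := F) (E := N) S
    have hFN₁deg : relFinrank F N₁ hFN₁ = q ^ a := by
      have ht := (rel_tower (V := V) hFN₁ hN₁N).2.2
      rw [hN₁Ndeg] at ht
      have : relFinrank F N (hFN₁.trans hN₁N) = q ^ (a + 1) := hdeg
      rw [this, pow_succ] at ht
      exact (Nat.eq_of_mul_eq_mul_right hq.pos ht).symm
    have hN₁ : IsHenselianField N₁ (V.comap (algebraMap N₁ Ω)) :=
      hF.of_subfield_le V hFN₁ (forall_isAlgebraic_of_relFinite hFN₁ hfinFN₁)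
    have h1 := ih F N₁ hFN₁ hF hfinFN₁ hgalFN₁ hFN₁deg
    have h2 := rel_mul_eq_of_isGalois_prime V hN₁N hN₁ hfinN₁N hgalN₁N hq hqp hN₁Ndeg
    obtain ⟨hte, htf, -⟩ := rel_tower (V := V) hFN₁ hN₁N
    have hte' : relRamificationIndex V F N h = _ := hte
    have htf' : relInertiaDegree V F N h = _ := htf
    rw [hte', htf', pow_succ, ← h1, ← h2]
    ring

/-- **Ostrowski's lemma for a finite Galois extension of a henselian field** (inside the
algebraically closed valued field `(Ω, V)`): `[N : F] = e(N|F)·f(N|F)·p^ν` for some `ν`, `p`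
the characteristic exponent of the residue field. For each prime `r ≠ p`, a Sylow
`r`-subgroup `Q` of `G = Gal(N|F)` with fixed field `S` gives `e f(N|F) = e f(S|F)·e f(N|S)`
with `e f(N|S) = |Q|` (`rel_mul_eq_of_isGalois_prime_pow`, `S` henselian) and `r ∤ e f(S|F)`
(its prime divisors divide `[S : F] = (G : Q)`, `dvd_relFinrank_of_prime_dvd`); so `e f` and
`n` agree at every prime `r ≠ p`, and `e f ≤ n`. (ZS VI §12, Thm. 25, Corollary: "`efg`
divides `n`, and `n/efg` is a power of `π`", with `g = 1`.)
[cite: ZariskiSamuel1960, Ch. VI §12, Thm. 25, Corollary] -/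
theorem exists_relFinrank_eq_mul_pow_of_isGalois {F N : Subfield Ω} (h : F ≤ N)
    (hF : IsHenselianField F (V.comap (algebraMap F Ω))) (hfin : RelFinite F N h)
    (hgal : letI : Algebra F N := (Subfield.inclusion h).toAlgebra; IsGalois F N) :
    ∃ ν : ℕ, relFinrank F N h = relRamificationIndex V F N h * relInertiaDegree V F N h *
      ringExpChar (ResidueField V) ^ ν := by
  letI : Algebra F N := (Subfield.inclusion h).toAlgebra
  haveI : IsScalarTower F N Ω := IsScalarTower.of_algebraMap_eq fun _ => rfl
  haveI : FiniteDimensional F N := hfin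
  haveI : IsGalois F N := hgal
  set p := ringExpChar (ResidueField V) with hp
  set n := relFinrank F N h with hn
  obtain ⟨he1, hf1⟩ := one_le_relRamificationIndex_and_relInertiaDegree (V := V) h hfin
  have hle : relRamificationIndex V F N h * relInertiaDegree V F N h ≤ n :=
    relRamificationIndex_mul_relInertiaDegree_le (V := V) h hfin
  refine exists_eq_mul_pow_of_factorization_eq (Nat.mul_pos he1 hf1) hle fun r hr hrp => ?_
  -- the Sylow `r`-subgroup and its fixed field `S`
  haveI : Fact r.Prime := ⟨hr⟩
  have hcard : Nat.card (N ≃ₐ[F] N) = n := by rw [IsGalois.card_aut_eq_finrank]; rfl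
  obtain ⟨Q⟩ : Nonempty (Sylow r (N ≃ₐ[F] N)) := inferInstance
  haveI : (Q : Subgroup (N ≃ₐ[F] N)).FiniteIndex := Subgroup.finiteIndex_of_finite
  set a := n.factorization r with ha
  have hQcard : Nat.card Q = r ^ a := by rw [ha, Sylow.card_eq_multiplicity, hcard]
  have hidx : ¬ r ∣ (Q : Subgroup (N ≃ₐ[F] N)).index := Q.not_dvd_index
  let S' : IntermediateField F N := IntermediateField.fixedField (Q : Subgroup (N ≃ₐ[F] N))
  let S : Subfield Ω := liftSubfield S'
  have hFS : F ≤ S := le_liftSubfield S'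
  have hSN : S ≤ N := liftSubfield_le S'
  have hSNdeg : relFinrank S N hSN = r ^ a := by
    rw [relFinrank_liftSubfield_eq, IntermediateField.finrank_fixedField_eq_card, hQcard]
  have hfinSN : RelFinite S N hSN := relFinite_liftSubfield S'
  have hfinFS : RelFinite F S hFS := relFinite_liftSubfield_bot S'
  have hgalSN := isGalois_liftSubfield_top (M := F) (E := N) S'
  have hFSdeg : relFinrank F S hFS = (Q : Subgroup (N ≃ₐ[F] N)).index := by
    have ht := (rel_tower (V := V) hFS hSN).2.2
    rw [hSNdeg] at ht
    have h1 : relFinrank F N (hFS.trans hSN) = n := rfl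
    have h2 : (Q : Subgroup (N ≃ₐ[F] N)).index * r ^ a = n := by
      rw [← hQcard, mul_comm, Subgroup.card_mul_index, hcard]
    rw [h1, ← h2] at ht
    exact (Nat.eq_of_mul_eq_mul_right (Nat.pow_pos hr.pos) ht).symm
  have hS : IsHenselianField S (V.comap (algebraMap S Ω)) :=
    hF.of_subfield_le V hFS (forall_isAlgebraic_of_relFinite hFS hfinFS)
  -- `e f(N|S) = |Q|`, `r ∤ e f(S|F)`
  have hSN' : relRamificationIndex V S N hSN * relInertiaDegree V S N hSN = r ^ a :=
    rel_mul_eq_of_isGalois_prime_pow V hr hrp _ S N hSN hS hfinSN hgalSN hSNdeg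
  have hFS' : ¬ r ∣ relRamificationIndex V F S hFS * relInertiaDegree V F S hFS := fun hd =>
    hidx (hFSdeg ▸ dvd_relFinrank_of_prime_dvd V hFS hF hfinFS hr hd)
  obtain ⟨hte, htf, -⟩ := rel_tower (V := V) hFS hSN
  have hte' : relRamificationIndex V F N h = _ := hte
  have htf' : relInertiaDegree V F N h = _ := htf
  have hprod : relRamificationIndex V F N h * relInertiaDegree V F N h =
      (relRamificationIndex V F S hFS * relInertiaDegree V F S hFS) *
        (relRamificationIndex V S N hSN * relInertiaDegree V S N hSN) := by
    rw [hte', htf']; ring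
  obtain ⟨heS, hfS⟩ := one_le_relRamificationIndex_and_relInertiaDegree (V := V) hFS hfinFS
  have hpos1 : relRamificationIndex V F S hFS * relInertiaDegree V F S hFS ≠ 0 :=
    (Nat.mul_pos heS hfS).ne'
  have hpos2 : relRamificationIndex V S N hSN * relInertiaDegree V S N hSN ≠ 0 := by
    rw [hSN']; exact (Nat.pow_pos hr.pos).ne'
  rw [hprod, Nat.factorization_mul hpos1 hpos2, Finsupp.add_apply, hSN',
    Nat.factorization_eq_zero_of_not_dvd hFS', hr.factorization_pow, Finsupp.single_eq_same,
    zero_add]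

end Galois

end Literature.AlgebraicGeometry.Resolution
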